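import Literature.NumberTheory.LFunctions.SuzukiScrewLineRepaired
import Literature.NumberTheory.LFunctions.SuzukiWeilHatValueProofs
import Literature.NumberTheory.LFunctions.ZetaScrewNullSeriesProofs
import Literature.NumberTheory.LFunctions.ZetaScrewLemma21Proofs
import HarnessLib

/-!
# The zero expansion (3.7)ᴿ of `P̂ᴿ_φ` and CJM Lemma 3.2 (iii) for the repaired screw line (row G-dbl-31, sequel)

LINE 1 — LABEL: RH-FREE proofs (theorems only; no definition, no named fact). bears_on: B-C/B-P (LADDER-RH
COLUMN 6 DBR). WHAT THIS IS NOT: RH-free identities for explicit functions built from the zeros of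
`ξ`, modulo the RH-free printed identity CJM Prop 3.1 (`Suzuki2025_prop31`, hypothesis `h31`, never
asserted); nothing here bears on the truth of RH.

Source: M. Suzuki, Canad. J. Math. 2025 = arXiv:2301.00421v3, §3.3 (3.5)–(3.9), Lemma 3.2, over the
REPAIRED objects of `SuzukiScrewLineRepaired.lean` (erratum E21: the printed even extension
`𝔖_{−t} := 𝔖_t` replaced by the zero-expansion convention `𝔓ᴿ_t(z) = 𝔓_{|t|}(−z)`, `t < 0`).

## What is proved (all modulo `h31 : Suzuki2025_prop31`, which dbl-t6/t7 are discharging)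

* `screwPhatR_eq_tsum_of_prop31` — **(3.7)ᴿ on the real line**: for every test function `φ` and every
  real `x` with `x ≠ 0`, `E_ξ(x) ≠ 0` and `±x ∉ Γ`,
  `P̂ᴿ_φ(x) = −(i/2)(1 + Θ(x)) · Σ_ρ m_ρ c_ρ(φ) / (γ̄_ρ (x − γ̄_ρ))`,
  `c_ρ(φ) := ∫_ℝ (e^{i γ̄_ρ t} − 1) φ(t) dt` (`= φ̂(γ̄_ρ) − φ̂(0)`; `γ̄_ρ = γ_{1−ρ̄}` runs over `Γ` as
  `ρ` does): the half-line `t ≥ 0` contributes `∫_{t≥0}` (CJM Prop 3.1 at `x`), the half-line `t < 0`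
  contributes `∫_{t<0}` AFTER the reflection `γ ↦ −γ` (`ρ ↦ 1 − ρ`) — with the printed even extension
  the second piece would instead carry `e^{−iγ̄t}`, and no `φ̂` appears (E21).
* `Suzuki2025_lemma32R_iii_of_prop31` — **CJM Lemma 3.2 (iii), repaired**: `‖ψ‖₀ᴿ = 0 ⇒ ψ = 0` on
  `C_c^∞(ℝ)`, following the printed proof (TeX l.1085–1093): `P̂ᴿ_{Dψ} = 0` a.e. ⇒ the meromorphic
  `Σ_ρ a_ρ/(z − γ̄_ρ)` vanishes on `ℝ` a.e., hence identically off `Γ̄` (identity theorem), hence every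
  residue `a_ρ = m_ρ c_ρ(Dψ)/γ̄_ρ` vanishes ("it is impossible" that a non-trivial pole series vanishes);
  so `∫(e^{(ρ−½)t} − 1)ψ′(t)dt = 0` for all zeros `ρ`, whence `ψ′ = 0` by [Su22, Lemma 2.1] (the tree's
  `Suzuki2023_lemma21_holds` through `ZetaScrewNullSeries.ae_eq_zero_of_forall_zero`) and `ψ = 0`
  (compact support); and `Suzuki2025_lemma32R_of_prop31 : Suzuki2025_prop31 → Suzuki2025_lemma32R`.

## References
* [Suzuki2025WeilHilbertSpace] CJM 2025 = arXiv:2301.00421v3: (3.5)–(3.9) TeX l.1019–1064, Lemma 3.2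
  l.1073–1093, Prop 3.1 l.789–793.
* [Suzuki2023] M. Suzuki, J. London Math. Soc. 2023, Lemma 2.1 (tree `Suzuki2023_lemma21_holds`).
-/

noncomputable section

open MeasureTheory Complex Filter Set Real
open Literature.Analysis.DeBrangesSpaces (sharp sharp_apply sharp_ofReal sharp_sharp)
open scoped ComplexConjugate Topology

namespace Literature.NumberTheory.LFunctions

open ScrewLineEvenExtension ScrewLineL2 ZetaZeros

namespace ScrewLineRepairedExpansion

/-! ## A. The reflection `ρ ↦ 1 − ρ` of the zeros and elementary bounds -/

/-- The involution `ρ ↦ 1 − ρ` of the non-trivial zeros (`ξ(s) = ξ(1 − s)`), as an equivalence of the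
index type; on Suzuki's parameter it is `γ ↦ −γ` (`suzukiZeroParam_one_sub`).
[cite: Suzuki2025WeilHilbertSpace, p. 17 ("the symmetry γ ↦ −γ of Γ")] -/
theorem oneSub_mem (ρ : ZetaZeros.riemannZetaNontrivialZeros) : 1 - (ρ : ℂ) ∈ ZetaZeros.riemannZetaNontrivialZeros :=
  ZetaZeros.riemannZetaNontrivialZeros.one_sub_mem ρ.2

/-- `|Im ρ| ≤ ‖γ(ρ)‖` (`Re γ(ρ) = −Im ρ`). [cite: Suzuki2025WeilHilbertSpace, eq. (1.1) (γ = i(ρ − ½))] -/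
theorem abs_im_le_norm_zeroParam (ρ : ℂ) : |ρ.im| ≤ ‖suzukiZeroParam ρ‖ := by
  have h := Complex.abs_re_le_norm (suzukiZeroParam ρ)
  have : (suzukiZeroParam ρ).re = -ρ.im := by simp [suzukiZeroParam]
  rwa [this, abs_neg] at h

/-- `‖γ(ρ)‖ > 0` for a non-trivial zero (`Im ρ ≠ 0`). [cite: Suzuki2025WeilHilbertSpace, eq. (1.1)] -/
theorem norm_zeroParam_pos (ρ : ZetaZeros.riemannZetaNontrivialZeros) : 0 < ‖suzukiZeroParam (ρ : ℂ)‖ :=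
  lt_of_lt_of_le (abs_pos.2 (ZetaZeros.riemannZetaNontrivialZeros.im_ne_zero ρ.2))
    (abs_im_le_norm_zeroParam _)

/-- `conj γ(ρ) ≠ 0`. [cite: Suzuki2025WeilHilbertSpace, eq. (1.1)] -/
theorem conj_zeroParam_ne_zero (ρ : ZetaZeros.riemannZetaNontrivialZeros) : conj (suzukiZeroParam (ρ : ℂ)) ≠ 0 := by
  rw [map_ne_zero]
  exact norm_pos_iff.1 (norm_zeroParam_pos ρ)

/-- `|e^{i γ̄(ρ) t}| ≤ e^{|t|/2}` hence `‖e^{iγ̄t} − 1‖ ≤ e^{|t|/2} + 1` (`Re(iγ̄) = Re ρ − ½ ∈ (−½, ½)`).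
[cite: Suzuki2025WeilHilbertSpace, §3.1 (TeX l.776–781)] -/
theorem norm_cexp_conj_zeroParam_sub_one_le (ρ : ZetaZeros.riemannZetaNontrivialZeros) (t : ℝ) :
    ‖cexp (I * conj (suzukiZeroParam (ρ : ℂ)) * t) - 1‖ ≤ Real.exp (|t| / 2) + 1 := by
  obtain ⟨-, h0, h1⟩ := mem_riemannZetaNontrivialZeros_iff_holds.1 ρ.2
  have hre : (I * conj (suzukiZeroParam (ρ : ℂ)) * t).re = ((ρ : ℂ).re - 1 / 2) * t := by
    simp [suzukiZeroParam]; ring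
  calc ‖cexp (I * conj (suzukiZeroParam (ρ : ℂ)) * t) - 1‖
      ≤ ‖cexp (I * conj (suzukiZeroParam (ρ : ℂ)) * t)‖ + ‖(1 : ℂ)‖ := norm_sub_le _ _
    _ = Real.exp (((ρ : ℂ).re - 1 / 2) * t) + 1 := by rw [Complex.norm_exp, hre, norm_one]
    _ ≤ Real.exp (|t| / 2) + 1 := by
        gcongr
        have : ((ρ : ℂ).re - 1 / 2) * t ≤ |((ρ : ℂ).re - 1 / 2) * t| := le_abs_self _
        rw [abs_mul] at this
        have h2 : |(ρ : ℂ).re - 1 / 2| ≤ 1 / 2 := abs_le.2 ⟨by linarith, by linarith⟩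
        nlinarith [abs_nonneg t]

/-- **Summability of `Σ_ρ m_ρ/(‖γ_ρ‖ · ‖w − γ̄_ρ‖)`** for every complex `w` (junk `x/0 = 0` at a pole):
the far zeros (`|Im ρ| ≥ 2‖w‖ + 1`) contribute `≤ 4 m_ρ/(1 + Im ρ²)`, a convergent majorant
(`ZetaZeroSum.summable_zeroOrder_div_one_add_sq`). [cite: Suzuki2025WeilHilbertSpace, §3.1 (TeX l.776–781, "Σ m_γ|γ|^{−1−δ} < ∞")] -/
theorem summable_zeroOrder_div_norm_mul (w : ℂ) :
    Summable fun ρ : ZetaZeros.riemannZetaNontrivialZeros ↦ (riemannZetaZeroOrder (ρ : ℂ) : ℝ) /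
      (‖suzukiZeroParam (ρ : ℂ)‖ * ‖w - conj (suzukiZeroParam (ρ : ℂ))‖) := by
  refine Summable.of_norm_bounded_eventually
    ((ZetaZeroSum.summable_zeroOrder_div_one_add_sq).mul_left 4) ?_
  filter_upwards [(weilZeroFinset (2 * ‖w‖ + 1)).eventually_cofinite_notMem] with ρ hρ
  rw [mem_weilZeroFinset, not_le] at hρ
  have hm0 : (0 : ℝ) ≤ riemannZetaZeroOrder (ρ : ℂ) := ZetaZeroSum.zeroOrder_nonneg ρ
  have hγ := abs_im_le_norm_zeroParam (ρ : ℂ)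
  have him1 : 1 ≤ |(ρ : ℂ).im| := by linarith [norm_nonneg w]
  -- `‖w − γ̄‖ ≥ |Im ρ|/2`
  have hdist : |(ρ : ℂ).im| / 2 ≤ ‖w - conj (suzukiZeroParam (ρ : ℂ))‖ := by
    have h1 := norm_sub_norm_le (conj (suzukiZeroParam (ρ : ℂ))) w
    rw [norm_sub_rev, Complex.norm_conj] at h1
    linarith
  have hpos1 : 0 < ‖suzukiZeroParam (ρ : ℂ)‖ := by linarith
  have hpos2 : 0 < ‖w - conj (suzukiZeroParam (ρ : ℂ))‖ := by linarith
  rw [Real.norm_of_nonneg (div_nonneg hm0 (by positivity))]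
  calc (riemannZetaZeroOrder (ρ : ℂ) : ℝ) /
        (‖suzukiZeroParam (ρ : ℂ)‖ * ‖w - conj (suzukiZeroParam (ρ : ℂ))‖)
      ≤ (riemannZetaZeroOrder (ρ : ℂ) : ℝ) / (|(ρ : ℂ).im| * (|(ρ : ℂ).im| / 2)) := by
        gcongr
    _ = 2 * ((riemannZetaZeroOrder (ρ : ℂ) : ℝ) / (ρ : ℂ).im ^ 2) := by
        rw [← sq_abs]; field_simp
    _ ≤ 4 * ((riemannZetaZeroOrder (ρ : ℂ) : ℝ) / (1 + (ρ : ℂ).im ^ 2)) := by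
        rw [div_eq_mul_inv, div_eq_mul_inv]
        have him2 : 1 ≤ (ρ : ℂ).im ^ 2 := by nlinarith [sq_abs (ρ : ℂ).im]
        have hinv : ((ρ : ℂ).im ^ 2)⁻¹ ≤ 2 * (1 + (ρ : ℂ).im ^ 2)⁻¹ := by
          rw [← one_div, ← one_div, div_le_iff₀ (by positivity), mul_comm, ← mul_assoc,
            ← div_eq_mul_one_div, le_div_iff₀ (by positivity)]
          nlinarith
        nlinarith [mul_le_mul_of_nonneg_left hinv hm0]

/-! ## B. The termwise form of the repaired integrand (modulo Prop 3.1) -/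

/-- CJM Prop 3.1 at a REAL point: `𝔓_t(x) = P_t(x)` for every real `t` and every real `x ≠ 0` off `Γ`
(the other cancelling poles `i/2`, `−i(2n+½)` are non-real). [cite: Suzuki2025WeilHilbertSpace, Prop. 3.1 (TeX l.789–793)] -/
theorem screwP_ofReal_eq_of_prop31 (h31 : Suzuki2025_prop31) (t : ℝ) {x : ℝ} (hx0 : x ≠ 0)
    (hxΓ : ∀ ρ ∈ ZetaZeros.riemannZetaNontrivialZeros, (x : ℂ) ≠ suzukiZeroParam ρ) :
    screwP t x = screwZeroExpansion t x := by
  refine h31 t x (by exact_mod_cast hx0) (fun h ↦ ?_) (fun n h ↦ ?_) hxΓ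
  · have := congrArg Complex.im h; simp at this
  · have := congrArg Complex.im h; simp at this; linarith [n.cast_nonneg (α := ℝ)]

/-- The conjugated term of (3.2): `conj[m (e^{−iγ|t|} − 1)/γ · 1/(x − γ)] = m (e^{iγ̄|t|} − 1)/γ̄ · 1/(x − γ̄)`
for real `x`. [cite: Suzuki2025WeilHilbertSpace, (3.2)/(3.6) (TeX l.768–781, l.1026–1032)] -/
theorem conj_zeroTerm (ρ : ZetaZeros.riemannZetaNontrivialZeros) (t x : ℝ) :
    conj ((riemannZetaZeroOrder (ρ : ℂ) : ℂ) *
        ((cexp (-(I * suzukiZeroParam (ρ : ℂ) * (|t| : ℝ))) - 1) / suzukiZeroParam (ρ : ℂ)) *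
        (1 / ((x : ℂ) - suzukiZeroParam (ρ : ℂ)))) =
      (riemannZetaZeroOrder (ρ : ℂ) : ℂ) *
        ((cexp (I * conj (suzukiZeroParam (ρ : ℂ)) * (|t| : ℝ)) - 1) /
          conj (suzukiZeroParam (ρ : ℂ))) *
        (1 / ((x : ℂ) - conj (suzukiZeroParam (ρ : ℂ)))) := by
  simp only [map_mul, map_div₀, map_sub, map_one, Complex.conj_ofReal, map_intCast,
    ← Complex.exp_conj, map_neg, Complex.conj_I]
  ring_nf

/-- **The conjugated screw line as a zero sum (modulo Prop 3.1)**: for real `t` and real `x ≠ 0` off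
`Γ`, `conj 𝔖_t(x) = −(i/2)(1 + Θ(x)) · Σ_ρ m_ρ (e^{iγ̄_ρ|t|} − 1)/γ̄_ρ · 1/(x − γ̄_ρ)` (this is (3.6)
conjugated, written over the tree's objects). [cite: Suzuki2025WeilHilbertSpace, (3.6) (TeX l.1026–1032) with Prop. 3.1] -/
theorem conj_screwLine_ofReal_eq_tsum (h31 : Suzuki2025_prop31) (t : ℝ) {x : ℝ} (hx0 : x ≠ 0)
    (hxΓ : ∀ ρ ∈ ZetaZeros.riemannZetaNontrivialZeros, (x : ℂ) ≠ suzukiZeroParam ρ) :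
    conj (screwLine t x) = -(I / 2) * (1 + lagariasTheta x) *
      ∑' ρ : ZetaZeros.riemannZetaNontrivialZeros, (riemannZetaZeroOrder (ρ : ℂ) : ℂ) *
        ((cexp (I * conj (suzukiZeroParam (ρ : ℂ)) * (|t| : ℝ)) - 1) /
          conj (suzukiZeroParam (ρ : ℂ))) *
        (1 / ((x : ℂ) - conj (suzukiZeroParam (ρ : ℂ)))) := by
  rw [screwLine, screwP_ofReal_eq_of_prop31 h31 t hx0 hxΓ, screwZeroExpansion, map_mul,
    Complex.conj_tsum]
  simp only [conj_zeroTerm]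
  congr 1
  rw [map_div₀, map_mul, Complex.conj_I, map_add, map_one, sharp_ofReal, Complex.conj_conj]
  simp only [map_ofNat]
  ring

/-! ## C. Termwise integration of a zero series against a test function -/

/-- `‖e^{bt} − 1‖ ≤ e^{|t|/2} + 1` when `|Re b| ≤ ½`. [cite: Suzuki2025WeilHilbertSpace, §3.1 (TeX l.776–781)] -/
theorem norm_cexp_mul_sub_one_le {b : ℂ} (hb : |b.re| ≤ 1 / 2) (t : ℝ) :
    ‖cexp (b * t) - 1‖ ≤ Real.exp (|t| / 2) + 1 := by
  calc ‖cexp (b * t) - 1‖ ≤ ‖cexp (b * t)‖ + ‖(1 : ℂ)‖ := norm_sub_le _ _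
    _ = Real.exp (b.re * t) + 1 := by
        rw [Complex.norm_exp, norm_one]; simp
    _ ≤ Real.exp (|t| / 2) + 1 := by
        gcongr
        have h1 : b.re * t ≤ |b.re * t| := le_abs_self _
        rw [abs_mul] at h1
        nlinarith [abs_nonneg t, abs_nonneg b.re]

/-- For a test function `φ` vanishing off `{|t| ≤ R}` and `|Re b| ≤ ½`:
`‖(e^{bt} − 1)φ(t)‖ ≤ (e^{R/2} + 1)‖φ(t)‖`. [cite: Suzuki2025WeilHilbertSpace, (3.7) (TeX l.1040–1049)] -/
theorem norm_expCoeffIntegrand_le {φ : ℝ → ℂ} {R : ℝ} (hR : ∀ t, R < |t| → φ t = 0) {b : ℂ}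
    (hb : |b.re| ≤ 1 / 2) (t : ℝ) :
    ‖(cexp (b * t) - 1) * φ t‖ ≤ (Real.exp (R / 2) + 1) * ‖φ t‖ := by
  by_cases ht : |t| ≤ R
  · rw [norm_mul]
    gcongr
    exact (norm_cexp_mul_sub_one_le hb t).trans (by gcongr)
  · rw [hR t (lt_of_not_ge ht)]
    simp

/-- Integrability on any set of `t ↦ (e^{bt} − 1)φ(t)`, `φ` a test function, `|Re b| ≤ ½`.
[cite: Suzuki2025WeilHilbertSpace, (3.7) (TeX l.1040–1049)] -/
theorem integrableOn_expCoeffIntegrand {φ : ℝ → ℂ} (hφ : IsWeilTest φ) {b : ℂ} (hb : |b.re| ≤ 1 / 2)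
    (S : Set ℝ) : IntegrableOn (fun t : ℝ ↦ (cexp (b * t) - 1) * φ t) S := by
  obtain ⟨R, -, hR⟩ := hφ.2.exists_pos_le_norm
  have hR' : ∀ t, R < |t| → φ t = 0 := fun t ht ↦ hR t (by rw [Real.norm_eq_abs]; exact ht.le)
  have hφi : Integrable φ := hφ.1.continuous.integrable_of_hasCompactSupport hφ.2
  have hc : Continuous fun t : ℝ ↦ (cexp (b * t) - 1) * φ t :=
    (by fun_prop : Continuous fun t : ℝ ↦ cexp (b * t) - 1).mul hφ.1.continuous
  exact (((hφi.norm.const_mul (Real.exp (R / 2) + 1))).mono' hc.aestronglyMeasurable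
    (ae_of_all _ (norm_expCoeffIntegrand_le hR' hb))).integrableOn

/-- Uniform bound `∫_S ‖(e^{bt} − 1)φ(t)‖ dt ≤ (e^{R/2} + 1)‖φ‖₁` (`|Re b| ≤ ½`, any measurable `S`).
[cite: Suzuki2025WeilHilbertSpace, (3.7) (TeX l.1040–1049)] -/
theorem exists_setIntegral_norm_expCoeffIntegrand_le {φ : ℝ → ℂ} (hφ : IsWeilTest φ) :
    ∃ M : ℝ, 0 ≤ M ∧ ∀ (b : ℂ), |b.re| ≤ 1 / 2 → ∀ (S : Set ℝ), MeasurableSet S →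
      ∫ t in S, ‖(cexp (b * t) - 1) * φ t‖ ≤ M := by
  obtain ⟨R, -, hR⟩ := hφ.2.exists_pos_le_norm
  have hR' : ∀ t, R < |t| → φ t = 0 := fun t ht ↦ hR t (by rw [Real.norm_eq_abs]; exact ht.le)
  have hφi : Integrable φ := hφ.1.continuous.integrable_of_hasCompactSupport hφ.2
  refine ⟨(Real.exp (R / 2) + 1) * ∫ t, ‖φ t‖, by positivity, fun b hb S hS ↦ ?_⟩
  calc ∫ t in S, ‖(cexp (b * t) - 1) * φ t‖
      ≤ ∫ t in S, (Real.exp (R / 2) + 1) * ‖φ t‖ :=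
        setIntegral_mono_on (integrableOn_expCoeffIntegrand hφ hb S).norm
          ((hφi.norm.const_mul _).integrableOn) hS (fun t _ ↦ norm_expCoeffIntegrand_le hR' hb t)
    _ ≤ ∫ t, (Real.exp (R / 2) + 1) * ‖φ t‖ :=
        setIntegral_le_integral (hφi.norm.const_mul _) (ae_of_all _ fun t ↦ by positivity)
    _ = (Real.exp (R / 2) + 1) * ∫ t, ‖φ t‖ := integral_const_mul _ _

/-- **Termwise integration.** For a test function `φ`, absolutely summable coefficients `a_ρ` and
exponents `b_ρ` with `|Re b_ρ| ≤ ½`, on any measurable `S`: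
`∫_S Σ_ρ a_ρ(e^{b_ρt} − 1)φ(t) dt = Σ_ρ a_ρ ∫_S (e^{b_ρt} − 1)φ(t) dt`, and the right-hand family is
summable. [cite: Suzuki2025WeilHilbertSpace, (3.7) (TeX l.1040–1049, "by definition (1.7)")] -/
theorem setIntegral_tsum_expCoeff {φ : ℝ → ℂ} (hφ : IsWeilTest φ) {a b : ZetaZeros.riemannZetaNontrivialZeros → ℂ}
    (ha : Summable fun ρ ↦ ‖a ρ‖) (hb : ∀ ρ, |(b ρ).re| ≤ 1 / 2) {S : Set ℝ} (hS : MeasurableSet S) :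
    (∫ t in S, ∑' ρ : ZetaZeros.riemannZetaNontrivialZeros, a ρ * ((cexp (b ρ * t) - 1) * φ t)) =
        ∑' ρ : ZetaZeros.riemannZetaNontrivialZeros, a ρ * ∫ t in S, (cexp (b ρ * t) - 1) * φ t ∧
      Summable fun ρ : ZetaZeros.riemannZetaNontrivialZeros ↦ a ρ * ∫ t in S, (cexp (b ρ * t) - 1) * φ t := by
  obtain ⟨M, hM0, hM⟩ := exists_setIntegral_norm_expCoeffIntegrand_le hφ
  have hint : ∀ ρ : ZetaZeros.riemannZetaNontrivialZeros, Integrable (fun t : ℝ ↦ a ρ * ((cexp (b ρ * t) - 1) * φ t))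
      (volume.restrict S) := fun ρ ↦ (integrableOn_expCoeffIntegrand hφ (hb ρ) S).const_mul _
  have hnorm : ∀ ρ : ZetaZeros.riemannZetaNontrivialZeros, ∫ t in S, ‖a ρ * ((cexp (b ρ * t) - 1) * φ t)‖ ≤ ‖a ρ‖ * M := by
    intro ρ
    simp_rw [norm_mul (a ρ)]
    rw [integral_const_mul]
    exact mul_le_mul_of_nonneg_left (by simpa only [norm_mul] using hM (b ρ) (hb ρ) S hS)
      (norm_nonneg _)
  have hsum : Summable fun ρ : ZetaZeros.riemannZetaNontrivialZeros ↦ ∫ t in S, ‖a ρ * ((cexp (b ρ * t) - 1) * φ t)‖ :=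
    Summable.of_nonneg_of_le (fun ρ ↦ integral_nonneg fun _ ↦ norm_nonneg _) hnorm (ha.mul_right M)
  refine ⟨?_, ?_⟩
  · rw [← integral_tsum_of_summable_integral_norm hint hsum]
    exact tsum_congr fun ρ ↦ integral_const_mul _ _
  · refine Summable.of_norm_bounded (g := fun ρ ↦ ‖a ρ‖ * M) (ha.mul_right M) fun ρ ↦ ?_
    rw [norm_mul]
    refine mul_le_mul_of_nonneg_left ?_ (norm_nonneg _)
    refine (norm_integral_le_integral_norm _).trans ?_
    simpa only [norm_mul] using hM (b ρ) (hb ρ) S hS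

/-! ## D. (3.7)ᴿ: the zero expansion of `P̂ᴿ_φ` on the real line -/

/-- The coefficient `a_ρ(K, y) = K m_ρ/(γ̄_ρ (y − γ̄_ρ))` is absolutely summable (any `K`, `y`).
[cite: Suzuki2025WeilHilbertSpace, §3.1 (TeX l.776–781)] -/
theorem summable_norm_coeff (K y : ℂ) :
    Summable fun ρ : ZetaZeros.riemannZetaNontrivialZeros ↦ ‖K * ((riemannZetaZeroOrder (ρ : ℂ) : ℂ) /
      (conj (suzukiZeroParam (ρ : ℂ)) * (y - conj (suzukiZeroParam (ρ : ℂ)))))‖ := by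
  have h := (summable_zeroOrder_div_norm_mul y).mul_left ‖K‖
  refine h.congr fun ρ ↦ ?_
  have hm0 : (0 : ℝ) ≤ riemannZetaZeroOrder (ρ : ℂ) := ZetaZeroSum.zeroOrder_nonneg ρ
  rw [norm_mul, norm_div, norm_mul, Complex.norm_conj, Complex.norm_intCast, abs_of_nonneg hm0]

/-- **(3.7)ᴿ — the zero expansion of `P̂ᴿ_φ` on the real line (modulo CJM Prop 3.1).** For a test
function `φ` and a real `x ≠ 0` with `E_ξ(x) ≠ 0` and `±x ∉ Γ`:
`P̂ᴿ_φ(x) = −(i/2)(1 + Θ(x)) Σ_ρ m_ρ c_ρ(φ)/(γ̄_ρ (x − γ̄_ρ))`, `c_ρ(φ) = ∫_ℝ (e^{iγ̄_ρt} − 1)φ(t)dt`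
(`= φ̂(γ̄_ρ) − φ̂(0)`; as `ρ` runs over the zeros so does `1 − ρ̄`, whose parameter is `γ̄_ρ`). The
half-line `t ≥ 0` is CJM Prop 3.1 at `x`; the half-line `t < 0` is Prop 3.1 at `−x` followed by the
reflection `ρ ↦ 1 − ρ` (`γ ↦ −γ`) — the two then share the kernel `1/(x − γ̄_ρ)` and the exponentials
`e^{iγ̄t}` on BOTH half-lines add up to the full integral `c_ρ(φ)`. (With the printed even extension the
second half-line carries `e^{−iγ̄t}` instead: erratum E21.) RH-FREE modulo `h31`.
[cite: Suzuki2025WeilHilbertSpace, (3.7) (TeX l.1040–1049) with Prop. 3.1; erratum E21] -/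
theorem screwPhatR_eq_tsum_of_prop31 (h31 : Suzuki2025_prop31) {φ : ℝ → ℂ} (hφ : IsWeilTest φ)
    {x : ℝ} (hx0 : x ≠ 0) (hE : lagariasE x ≠ 0)
    (hxΓ : ∀ ρ ∈ ZetaZeros.riemannZetaNontrivialZeros, (x : ℂ) ≠ suzukiZeroParam ρ)
    (hxΓ' : ∀ ρ ∈ ZetaZeros.riemannZetaNontrivialZeros, -(x : ℂ) ≠ suzukiZeroParam ρ) :
    screwPhatR φ x = -(I / 2) * (1 + lagariasTheta x) *
      ∑' ρ : ZetaZeros.riemannZetaNontrivialZeros, (riemannZetaZeroOrder (ρ : ℂ) : ℂ) *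
        (∫ t : ℝ, (cexp (I * conj (suzukiZeroParam (ρ : ℂ)) * t) - 1) * φ t) /
        (conj (suzukiZeroParam (ρ : ℂ)) * ((x : ℂ) - conj (suzukiZeroParam (ρ : ℂ)))) := by
  -- notation
  set K : ℂ := -(I / 2) * (1 + lagariasTheta x) with hK
  set γ : ZetaZeros.riemannZetaNontrivialZeros → ℂ := fun ρ ↦ suzukiZeroParam (ρ : ℂ) with hγ
  set m : ZetaZeros.riemannZetaNontrivialZeros → ℂ := fun ρ ↦ (riemannZetaZeroOrder (ρ : ℂ) : ℂ) with hm
  set a : ZetaZeros.riemannZetaNontrivialZeros → ℂ := fun ρ ↦ K * (m ρ / conj (γ ρ) * (1 / ((x : ℂ) - conj (γ ρ)))) with ha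
  set a' : ZetaZeros.riemannZetaNontrivialZeros → ℂ := fun ρ ↦ K * (m ρ / conj (γ ρ) * (1 / (-(x : ℂ) - conj (γ ρ)))) with ha'
  have hb : ∀ ρ : ZetaZeros.riemannZetaNontrivialZeros, |(I * conj (γ ρ)).re| ≤ 1 / 2 := by
    intro ρ
    obtain ⟨-, h0, h1⟩ := mem_riemannZetaNontrivialZeros_iff_holds.1 ρ.2
    have : (I * conj (γ ρ)).re = (ρ : ℂ).re - 1 / 2 := by simp [hγ, suzukiZeroParam]
    rw [this]; exact abs_le.2 ⟨by linarith, by linarith⟩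
  have hb' : ∀ ρ : ZetaZeros.riemannZetaNontrivialZeros, |(-(I * conj (γ ρ))).re| ≤ 1 / 2 := fun ρ ↦ by
    rw [Complex.neg_re, abs_neg]; exact hb ρ
  have hsum_a : Summable fun ρ ↦ ‖a ρ‖ :=
    (summable_norm_coeff K x).congr fun ρ ↦ by
      simp only [ha, hγ, hm]; rw [div_mul_eq_div_div]; ring_nf
  have hsum_a' : Summable fun ρ ↦ ‖a' ρ‖ :=
    (summable_norm_coeff K (-(x : ℂ))).congr fun ρ ↦ by
      simp only [ha', hγ, hm]; rw [div_mul_eq_div_div]; ring_nf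
  -- Θ(x) ≠ 0 and Θ♯(x) ≠ 0
  have hsE : sharp lagariasE (x : ℂ) ≠ 0 := by rw [sharp_ofReal, map_ne_zero]; exact hE
  have hΘ : lagariasTheta (x : ℂ) ≠ 0 := div_ne_zero hsE hE
  have hsΘ : sharp lagariasTheta (x : ℂ) ≠ 0 := by rw [sharp_ofReal, map_ne_zero]; exact hΘ
  have hnx0 : -x ≠ 0 := neg_ne_zero.2 hx0
  have hxΓn : ∀ ρ ∈ ZetaZeros.riemannZetaNontrivialZeros, ((-x : ℝ) : ℂ) ≠ suzukiZeroParam ρ := by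
    intro ρ hρ; rw [Complex.ofReal_neg]; exact hxΓ' ρ hρ
  -- pointwise expansions on the two half-lines
  have hIci : ∀ t ∈ Ici (0 : ℝ), sharp (screwLineR t) (x : ℂ) * φ t =
      ∑' ρ : ZetaZeros.riemannZetaNontrivialZeros, a ρ * ((cexp (I * conj (γ ρ) * t) - 1) * φ t) := by
    intro t ht
    rw [screwLineR_of_nonneg (mem_Ici.1 ht), sharp_ofReal,
      conj_screwLine_ofReal_eq_tsum h31 t hx0 hxΓ, abs_of_nonneg (mem_Ici.1 ht), ← hK,
      ← tsum_mul_left, ← tsum_mul_right]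
    refine tsum_congr fun ρ ↦ ?_
    simp only [ha, hγ, hm]
    ring
  have hIio : ∀ t ∈ (Ici (0 : ℝ))ᶜ, sharp (screwLineR t) (x : ℂ) * φ t =
      ∑' ρ : ZetaZeros.riemannZetaNontrivialZeros, a' ρ * ((cexp (-(I * conj (γ ρ)) * t) - 1) * φ t) := by
    intro t ht
    have ht' : t < 0 := by simpa using ht
    rw [sharp_ofReal, screwLineR_of_neg ht' hsΘ, map_mul, sharp_ofReal, Complex.conj_conj]
    have h := conj_screwLine_ofReal_eq_tsum h31 (-t) hnx0 hxΓn
    rw [Complex.ofReal_neg] at h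
    rw [h, abs_neg, abs_of_neg ht', lagariasTheta_neg]
    have hpre : lagariasTheta (x : ℂ) * (1 + (lagariasTheta (x : ℂ))⁻¹) = 1 + lagariasTheta x := by
      field_simp
      ring
    have hrew : ∀ S : ℂ, lagariasTheta (x : ℂ) * (-(I / 2) * (1 + (lagariasTheta (x : ℂ))⁻¹) * S) *
        φ t = K * S * φ t := fun S ↦ by
      rw [hK, ← hpre]; ring
    rw [hrew, ← tsum_mul_left, ← tsum_mul_right]
    refine tsum_congr fun ρ ↦ ?_
    have hexp : cexp (I * conj (γ ρ) * ((-t : ℝ) : ℂ)) = cexp (-(I * conj (γ ρ)) * (t : ℂ)) := by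
      congr 1; push_cast; ring
    simp only [hγ] at hexp
    rw [hexp]
    simp only [ha', hγ, hm]
    ring
  -- the integrand is integrable, split the integral at 0
  have hG : Integrable (fun t : ℝ ↦ sharp (screwLineR t) (x : ℂ) * φ t) :=
    integrable_screwPhatR_integrand hφ x
  have hsplit := integral_add_compl (μ := volume) (measurableSet_Ici (a := (0 : ℝ))) hG
  -- termwise integration on each half-line
  obtain ⟨hI₁, hS₁⟩ := setIntegral_tsum_expCoeff hφ hsum_a hb (measurableSet_Ici (a := (0 : ℝ)))
  obtain ⟨hI₂, -⟩ :=
    setIntegral_tsum_expCoeff hφ hsum_a' hb' (measurableSet_Ici (a := (0 : ℝ))).compl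
  obtain ⟨-, hS₃⟩ := setIntegral_tsum_expCoeff hφ hsum_a hb (measurableSet_Ici (a := (0 : ℝ))).compl
  have e₁ : ∫ t in Ici (0 : ℝ), sharp (screwLineR t) (x : ℂ) * φ t =
      ∑' ρ : ZetaZeros.riemannZetaNontrivialZeros, a ρ * ∫ t in Ici (0 : ℝ), (cexp (I * conj (γ ρ) * t) - 1) * φ t := by
    rw [setIntegral_congr_fun measurableSet_Ici hIci, hI₁]
  have e₂ : ∫ t in (Ici (0 : ℝ))ᶜ, sharp (screwLineR t) (x : ℂ) * φ t =
      ∑' ρ : ZetaZeros.riemannZetaNontrivialZeros, a' ρ * ∫ t in (Ici (0 : ℝ))ᶜ, (cexp (-(I * conj (γ ρ)) * t) - 1) * φ t := by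
    rw [setIntegral_congr_fun measurableSet_Ici.compl hIio, hI₂]
  -- reflect the second series by `ρ ↦ 1 − ρ`
  have hinv : Function.Involutive (fun ρ : ZetaZeros.riemannZetaNontrivialZeros ↦ (⟨1 - (ρ : ℂ), oneSub_mem ρ⟩ : ZetaZeros.riemannZetaNontrivialZeros)) := by
    intro ρ; ext; simp
  have e₃ : ∑' ρ : ZetaZeros.riemannZetaNontrivialZeros, a' ρ * ∫ t in (Ici (0 : ℝ))ᶜ, (cexp (-(I * conj (γ ρ)) * t) - 1) * φ t =
      ∑' ρ : ZetaZeros.riemannZetaNontrivialZeros, a ρ * ∫ t in (Ici (0 : ℝ))ᶜ, (cexp (I * conj (γ ρ) * t) - 1) * φ t := by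
    rw [← Equiv.tsum_eq (hinv.toPerm _)]
    refine tsum_congr fun ρ ↦ ?_
    have hγe : γ (hinv.toPerm _ ρ) = -γ ρ := by
      simp only [hγ, Function.Involutive.coe_toPerm]
      exact suzukiZeroParam_one_sub _
    have hme : m (hinv.toPerm _ ρ) = m ρ := by
      simp only [hm, Function.Involutive.coe_toPerm]
      exact_mod_cast riemannZetaZeroOrder_one_sub_of_mem ρ.2
    have ha_e : a' (hinv.toPerm _ ρ) = a ρ := by
      simp only [ha, ha', hγe, hme, map_neg]
      have hc : conj (γ ρ) ≠ 0 := conj_zeroParam_ne_zero ρ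
      rw [div_neg, show -(x : ℂ) - -conj (γ ρ) = -((x : ℂ) - conj (γ ρ)) by ring, one_div_neg_eq_neg_one_div]
      ring
    rw [ha_e, hγe]
    congr 1
    refine setIntegral_congr_fun measurableSet_Ici.compl fun t _ ↦ ?_
    rw [map_neg, mul_neg, neg_neg]
  -- the full-line coefficient
  have hfull : ∀ ρ : ZetaZeros.riemannZetaNontrivialZeros, (∫ t in Ici (0 : ℝ), (cexp (I * conj (γ ρ) * t) - 1) * φ t) +
      (∫ t in (Ici (0 : ℝ))ᶜ, (cexp (I * conj (γ ρ) * t) - 1) * φ t) =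
      ∫ t : ℝ, (cexp (I * conj (γ ρ) * t) - 1) * φ t := fun ρ ↦
    integral_add_compl measurableSet_Ici
      (integrableOn_univ.1 (integrableOn_expCoeffIntegrand hφ (hb ρ) univ))
  -- add up
  calc screwPhatR φ x = ∫ t, sharp (screwLineR t) (x : ℂ) * φ t := rfl
    _ = (∫ t in Ici (0 : ℝ), sharp (screwLineR t) (x : ℂ) * φ t) +
          ∫ t in (Ici (0 : ℝ))ᶜ, sharp (screwLineR t) (x : ℂ) * φ t := hsplit.symm
    _ = (∑' ρ : ZetaZeros.riemannZetaNontrivialZeros, a ρ * ∫ t in Ici (0 : ℝ), (cexp (I * conj (γ ρ) * t) - 1) * φ t) +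
          ∑' ρ : ZetaZeros.riemannZetaNontrivialZeros, a ρ * ∫ t in (Ici (0 : ℝ))ᶜ, (cexp (I * conj (γ ρ) * t) - 1) * φ t := by
        rw [e₁, e₂, e₃]
    _ = ∑' ρ : ZetaZeros.riemannZetaNontrivialZeros, (a ρ * (∫ t in Ici (0 : ℝ), (cexp (I * conj (γ ρ) * t) - 1) * φ t) +
          a ρ * ∫ t in (Ici (0 : ℝ))ᶜ, (cexp (I * conj (γ ρ) * t) - 1) * φ t) :=
        (hS₁.tsum_add hS₃).symm
    _ = ∑' ρ : ZetaZeros.riemannZetaNontrivialZeros, a ρ * ∫ t : ℝ, (cexp (I * conj (γ ρ) * t) - 1) * φ t :=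
        tsum_congr fun ρ ↦ by rw [← mul_add, hfull]
    _ = K * ∑' ρ : ZetaZeros.riemannZetaNontrivialZeros, m ρ * (∫ t : ℝ, (cexp (I * conj (γ ρ) * t) - 1) * φ t) /
          (conj (γ ρ) * ((x : ℂ) - conj (γ ρ))) := by
        rw [← tsum_mul_left]
        refine tsum_congr fun ρ ↦ ?_
        simp only [ha]
        rw [div_mul_eq_div_div]
        ring

/-! ## E. Pole series `Σ_ρ m_ρ c_ρ/(γ̄_ρ (z − γ̄_ρ))` with bounded coefficients: holomorphy off `Γ` -/

/-- The parameter set `Γ = {γ_ρ}` is closed under complex conjugation: `γ̄_ρ = γ_{1−ρ̄}`, so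
`ξ(½ − iz) ≠ 0` excludes `z = γ̄_ρ` as well. [cite: Suzuki2025WeilHilbertSpace, eq. (1.1) (the pairing γ ↔ γ̄)] -/
theorem ne_conj_zeroParam_of_xi_ne_zero {z : ℂ} (hz : riemannXi (1 / 2 - I * z) ≠ 0) (ρ : ZetaZeros.riemannZetaNontrivialZeros) :
    z ≠ conj (suzukiZeroParam (ρ : ℂ)) := by
  intro h
  apply hz
  rw [h, ← suzukiZeroParam_one_sub_conj, one_half_sub_I_mul_suzukiZeroParam]
  have hmem := ZetaZeros.riemannZetaNontrivialZeros.one_sub_conj_mem ρ.2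
  exact (riemannXi_eq_zero_iff_holds _).2 (mem_riemannZetaNontrivialZeros_iff_holds.1 hmem)

/-- `ξ(½ − iz) = 0` only on `Γ`. [cite: Suzuki2025WeilHilbertSpace, p. 2 ("Γ … the set of all zeros of ξ(1/2 − iz)")] -/
theorem ne_zeroParam_of_xi_ne_zero {z : ℂ} (hz : riemannXi (1 / 2 - I * z) ≠ 0) (ρ : ZetaZeros.riemannZetaNontrivialZeros) :
    z ≠ suzukiZeroParam (ρ : ℂ) := by
  intro h
  apply hz
  rw [h, one_half_sub_I_mul_suzukiZeroParam]
  exact (riemannXi_eq_zero_iff_holds _).2 (mem_riemannZetaNontrivialZeros_iff_holds.1 ρ.2)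

/-- Conversely, off `Γ` the function `ξ(½ − iz)` does not vanish. [cite: Suzuki2025WeilHilbertSpace, p. 2] -/
theorem xi_ne_zero_of_forall_ne {z : ℂ}
    (hz : ∀ ρ ∈ ZetaZeros.riemannZetaNontrivialZeros, z ≠ suzukiZeroParam ρ) :
    riemannXi (1 / 2 - I * z) ≠ 0 := by
  intro hxi
  have hmem := mem_riemannZetaNontrivialZeros_of_riemannXi_eq_zero hxi
  apply hz _ hmem
  rw [suzukiZeroParam]
  linear_combination z * Complex.I_sq

/-- **Holomorphy of a pole series off its poles (with finitely many terms removed).** For bounded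
coefficients `c_ρ` and a finite set `S` of zeros, `z ↦ Σ'_ρ [ρ ∉ S] m_ρ c_ρ/(γ̄_ρ (z − γ̄_ρ))` is
differentiable at every `z₀` avoiding the poles `γ̄_ρ`, `ρ ∉ S` (locally uniform convergence: the far
zeros contribute `≤ 4C m_ρ/(1 + Im ρ²)` on the unit ball around `z₀`).
[cite: Suzuki2025WeilHilbertSpace, §3.1 (TeX l.776–781, "converges absolutely and uniformly on every compact subset of ℂ ∖ Γ")] -/
theorem differentiableAt_poleSeries {c : ZetaZeros.riemannZetaNontrivialZeros → ℂ} {C : ℝ} (hC0 : 0 ≤ C) (hc : ∀ ρ, ‖c ρ‖ ≤ C)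
    (S : Finset ZetaZeros.riemannZetaNontrivialZeros) {z₀ : ℂ} (hz₀ : ∀ ρ : ZetaZeros.riemannZetaNontrivialZeros, ρ ∉ S → z₀ ≠ conj (suzukiZeroParam (ρ : ℂ))) :
    DifferentiableAt ℂ (fun z ↦ ∑' ρ : ZetaZeros.riemannZetaNontrivialZeros, if ρ ∈ S then 0 else
      (riemannZetaZeroOrder (ρ : ℂ) : ℂ) * c ρ /
        (conj (suzukiZeroParam (ρ : ℂ)) * (z - conj (suzukiZeroParam (ρ : ℂ))))) z₀ := by
  classical
  obtain ⟨H, hH⟩ : ∃ H : ZetaZeros.riemannZetaNontrivialZeros → ℂ → ℂ, H = fun ρ z ↦ if ρ ∈ S then 0 else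
      (riemannZetaZeroOrder (ρ : ℂ) : ℂ) * c ρ /
        (conj (suzukiZeroParam (ρ : ℂ)) * (z - conj (suzukiZeroParam (ρ : ℂ)))) := ⟨_, rfl⟩
  obtain ⟨R, hR⟩ : ∃ R : ℝ, R = 2 * (‖z₀‖ + 2) := ⟨_, rfl⟩
  set T : Finset ZetaZeros.riemannZetaNontrivialZeros := weilZeroFinset R ∪ S with hT
  -- each term is holomorphic off its pole
  have hterm : ∀ (ρ : ZetaZeros.riemannZetaNontrivialZeros) (z : ℂ), (ρ ∈ S ∨ z ≠ conj (suzukiZeroParam (ρ : ℂ))) →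
      DifferentiableAt ℂ (H ρ) z := by
    intro ρ z h
    rw [hH]
    by_cases hρ : ρ ∈ S
    · simp only [hρ, if_true]; exact differentiableAt_const _
    · simp only [hρ, if_false]
      have hne : z ≠ conj (suzukiZeroParam (ρ : ℂ)) := h.resolve_left hρ
      refine (differentiableAt_const _).div ((differentiableAt_const _).mul
        (differentiableAt_id.sub (differentiableAt_const _))) ?_
      exact mul_ne_zero (conj_zeroParam_ne_zero ρ) (sub_ne_zero.2 hne)
  -- far zeros: uniform bound on the unit ball around `z₀`
  have hfar : ∀ (ρ : ZetaZeros.riemannZetaNontrivialZeros), ρ ∉ T → ∀ z ∈ Metric.ball z₀ 1,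
      1 ≤ ‖z - conj (suzukiZeroParam (ρ : ℂ))‖ ∧
        ‖H ρ z‖ ≤ 4 * C * ((riemannZetaZeroOrder (ρ : ℂ) : ℝ) / (1 + (ρ : ℂ).im ^ 2)) := by
    intro ρ hρ z hz
    rw [hT, Finset.mem_union, not_or, mem_weilZeroFinset, not_le] at hρ
    rw [Metric.mem_ball, dist_eq_norm] at hz
    have hz' : ‖z‖ ≤ ‖z₀‖ + 1 := by
      have := norm_le_norm_add_norm_sub' z z₀; linarith
    have hγ := abs_im_le_norm_zeroParam (ρ : ℂ)
    have him1 : 1 ≤ |(ρ : ℂ).im| := by rw [hR] at hρ; linarith [norm_nonneg z₀]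
    have hdist : |(ρ : ℂ).im| / 2 ≤ ‖z - conj (suzukiZeroParam (ρ : ℂ))‖ := by
      have h1 := norm_sub_norm_le (conj (suzukiZeroParam (ρ : ℂ))) z
      rw [norm_sub_rev, Complex.norm_conj] at h1
      rw [hR] at hρ
      linarith
    have hm0 : (0 : ℝ) ≤ riemannZetaZeroOrder (ρ : ℂ) := ZetaZeroSum.zeroOrder_nonneg ρ
    refine ⟨by rw [hR] at hρ; linarith [norm_nonneg z₀], ?_⟩
    rw [hH]
    simp only [hρ.2, if_false]
    rw [norm_div, norm_mul, norm_mul, Complex.norm_intCast, abs_of_nonneg hm0, Complex.norm_conj]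
    have hγpos : 0 < ‖suzukiZeroParam (ρ : ℂ)‖ := by linarith
    have hzpos : 0 < ‖z - conj (suzukiZeroParam (ρ : ℂ))‖ := by linarith
    calc (riemannZetaZeroOrder (ρ : ℂ) : ℝ) * ‖c ρ‖ /
          (‖suzukiZeroParam (ρ : ℂ)‖ * ‖z - conj (suzukiZeroParam (ρ : ℂ))‖)
        ≤ (riemannZetaZeroOrder (ρ : ℂ) : ℝ) * C / (|(ρ : ℂ).im| * (|(ρ : ℂ).im| / 2)) := by
          gcongr
          exact hc ρ
      _ = 2 * C * ((riemannZetaZeroOrder (ρ : ℂ) : ℝ) / (ρ : ℂ).im ^ 2) := by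
          rw [← sq_abs]; field_simp
      _ ≤ 4 * C * ((riemannZetaZeroOrder (ρ : ℂ) : ℝ) / (1 + (ρ : ℂ).im ^ 2)) := by
          rw [div_eq_mul_inv, div_eq_mul_inv]
          have him2 : 1 ≤ (ρ : ℂ).im ^ 2 := by nlinarith [sq_abs (ρ : ℂ).im]
          have hinv : ((ρ : ℂ).im ^ 2)⁻¹ ≤ 2 * (1 + (ρ : ℂ).im ^ 2)⁻¹ := by
            rw [← one_div, ← one_div, div_le_iff₀ (by positivity), mul_comm, ← mul_assoc,
              ← div_eq_mul_one_div, le_div_iff₀ (by positivity)]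
            nlinarith
          nlinarith [mul_le_mul_of_nonneg_left hinv hm0, hm0, hC0,
            mul_nonneg (mul_nonneg hC0 hm0) (sub_nonneg.2 hinv)]
  -- summable majorant and holomorphic tail
  have hu : Summable fun ρ : {ρ : ZetaZeros.riemannZetaNontrivialZeros // ρ ∉ T} ↦
      4 * C * ((riemannZetaZeroOrder ((ρ : ZetaZeros.riemannZetaNontrivialZeros) : ℂ) : ℝ) / (1 + ((ρ : ZetaZeros.riemannZetaNontrivialZeros) : ℂ).im ^ 2)) :=
    (ZetaZeroSum.summable_zeroOrder_div_one_add_sq.mul_left (4 * C)).comp_injective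
      Subtype.val_injective
  have htail : DifferentiableOn ℂ (fun z ↦ ∑' ρ : {ρ : ZetaZeros.riemannZetaNontrivialZeros // ρ ∉ T}, H ρ z) (Metric.ball z₀ 1) := by
    refine differentiableOn_tsum_of_summable_norm hu (fun ρ z hz ↦ ?_) Metric.isOpen_ball
      (fun ρ z hz ↦ (hfar ρ ρ.2 z hz).2)
    refine (hterm ρ z (Or.inr fun h ↦ ?_)).differentiableWithinAt
    have h1 := (hfar ρ ρ.2 z hz).1
    rw [h, sub_self, norm_zero] at h1
    linarith
  have hhead : DifferentiableAt ℂ (fun z ↦ ∑ ρ ∈ T, H ρ z) z₀ := by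
    refine DifferentiableAt.fun_sum fun ρ hρ ↦ hterm ρ z₀ ?_
    by_cases hS : ρ ∈ S
    · exact Or.inl hS
    · exact Or.inr (hz₀ ρ hS)
  have hsum : ∀ z ∈ Metric.ball z₀ 1, Summable fun ρ ↦ H ρ z := fun z hz ↦
    (Finset.summable_compl_iff T).1 (Summable.of_norm_bounded hu fun ρ ↦ (hfar ρ ρ.2 z hz).2)
  have hev : (fun z ↦ (∑ ρ ∈ T, H ρ z) + ∑' ρ : {ρ : ZetaZeros.riemannZetaNontrivialZeros // ρ ∉ T}, H ρ z) =ᶠ[𝓝 z₀]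
      fun z ↦ ∑' ρ : ZetaZeros.riemannZetaNontrivialZeros, H ρ z := by
    filter_upwards [Metric.isOpen_ball.mem_nhds (Metric.mem_ball_self zero_lt_one)] with z hz
    rw [(hsum z hz).sum_add_tsum_subtype_compl T]
  have hfinal := ((hhead.add (htail.differentiableAt
    (Metric.isOpen_ball.mem_nhds (Metric.mem_ball_self zero_lt_one)))).congr_of_eventuallyEq
      hev.symm)
  rw [hH] at hfinal
  exact hfinal

/-- The pole series with bounded coefficients is (absolutely) summable at EVERY point (at a pole the
offending term is Lean's junk `x/0 = 0`). [cite: Suzuki2025WeilHilbertSpace, §3.1 (TeX l.776–781)] -/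
theorem summable_poleSeries {c : ZetaZeros.riemannZetaNontrivialZeros → ℂ} {C : ℝ} (hc : ∀ ρ, ‖c ρ‖ ≤ C) (z : ℂ) :
    Summable fun ρ : ZetaZeros.riemannZetaNontrivialZeros ↦ (riemannZetaZeroOrder (ρ : ℂ) : ℂ) * c ρ /
      (conj (suzukiZeroParam (ρ : ℂ)) * (z - conj (suzukiZeroParam (ρ : ℂ)))) := by
  refine Summable.of_norm_bounded ((summable_zeroOrder_div_norm_mul z).mul_left C) fun ρ ↦ ?_
  have hm0 : (0 : ℝ) ≤ riemannZetaZeroOrder (ρ : ℂ) := ZetaZeroSum.zeroOrder_nonneg ρ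
  rw [norm_div, norm_mul, norm_mul, Complex.norm_intCast, abs_of_nonneg hm0, Complex.norm_conj]
  calc (riemannZetaZeroOrder (ρ : ℂ) : ℝ) * ‖c ρ‖ /
        (‖suzukiZeroParam (ρ : ℂ)‖ * ‖z - conj (suzukiZeroParam (ρ : ℂ))‖)
      = ‖c ρ‖ * ((riemannZetaZeroOrder (ρ : ℂ) : ℝ) /
          (‖suzukiZeroParam (ρ : ℂ)‖ * ‖z - conj (suzukiZeroParam (ρ : ℂ))‖)) := by ring
    _ ≤ C * ((riemannZetaZeroOrder (ρ : ℂ) : ℝ) /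
          (‖suzukiZeroParam (ρ : ℂ)‖ * ‖z - conj (suzukiZeroParam (ρ : ℂ))‖)) :=
        mul_le_mul_of_nonneg_right (hc ρ) (by positivity)

/-- **A pole series with bounded coefficients that vanishes a.e. on `ℝ` has all residues zero** — the
"it is impossible" step of the printed proof of Lemma 3.2 ("there must exist a sequence `(c_γ)` such that
`Σ c_γ(z − γ)^{-1}` is identically zero on `ℂ` … but it is impossible"): the series is holomorphic on the
connected co-countable set `{ξ(½ − iz) ≠ 0} = ℂ ∖ Γ`, vanishes at almost every real point, hence
identically (identity theorem), and `(z − γ̄_ρ₀) · Σ → m_{ρ₀} c_{ρ₀}/γ̄_{ρ₀}` at the pole.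
[cite: Suzuki2025WeilHilbertSpace, Lemma 3.2, proof (TeX l.1085–1091)] -/
theorem coeff_eq_zero_of_poleSeries_ae_zero {c : ZetaZeros.riemannZetaNontrivialZeros → ℂ} {C : ℝ} (hC0 : 0 ≤ C)
    (hc : ∀ ρ, ‖c ρ‖ ≤ C)
    (hae : ∀ᵐ x : ℝ, ∑' ρ : ZetaZeros.riemannZetaNontrivialZeros, (riemannZetaZeroOrder (ρ : ℂ) : ℂ) * c ρ /
      (conj (suzukiZeroParam (ρ : ℂ)) * ((x : ℂ) - conj (suzukiZeroParam (ρ : ℂ)))) = 0)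
    (ρ₀ : ZetaZeros.riemannZetaNontrivialZeros) : c ρ₀ = 0 := by
  classical
  -- the series and the domain
  set Hs : ℂ → ℂ := fun z ↦ ∑' ρ : ZetaZeros.riemannZetaNontrivialZeros, (riemannZetaZeroOrder (ρ : ℂ) : ℂ) * c ρ /
      (conj (suzukiZeroParam (ρ : ℂ)) * (z - conj (suzukiZeroParam (ρ : ℂ)))) with hHs
  set U : Set ℂ := {z | riemannXi (1 / 2 - I * z) ≠ 0} with hU
  have hUo : IsOpen U := by
    have hc2 : Continuous fun z : ℂ ↦ riemannXi (1 / 2 - I * z) :=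
      differentiable_riemannXi.continuous.comp (by fun_prop)
    exact isOpen_ne_fun hc2 continuous_const
  have hcount : (Uᶜ).Countable := by
    refine (riemannZetaNontrivialZeros_countable.image suzukiZeroParam).mono fun z hz ↦ ?_
    rw [mem_compl_iff, hU, mem_setOf_eq, not_not] at hz
    have hmem := mem_riemannZetaNontrivialZeros_of_riemannXi_eq_zero hz
    refine ⟨_, hmem, ?_⟩
    rw [suzukiZeroParam]; linear_combination -z * Complex.I_sq
  have hUconn : IsPreconnected U := by
    have h2 : 1 < Module.rank ℝ ℂ := by
      rw [← Module.finrank_eq_rank, Complex.finrank_real_complex]; norm_num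
    have := (hcount.isPathConnected_compl_of_one_lt_rank h2).isConnected.isPreconnected
    rwa [compl_compl] at this
  -- holomorphy on `U`
  have hdiff : ∀ z ∈ U, DifferentiableAt ℂ Hs z := by
    intro z hz
    have h := differentiableAt_poleSeries hC0 hc ∅ (z₀ := z)
      (fun ρ _ ↦ ne_conj_zeroParam_of_xi_ne_zero hz ρ)
    simpa only [Finset.notMem_empty, if_false] using h
  have hdOn : DifferentiableOn ℂ Hs U := fun z hz ↦ (hdiff z hz).differentiableWithinAt
  have hHol : AnalyticOnNhd ℂ Hs U := hdOn.analyticOnNhd hUo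
  -- a.e. real point of `U` is a zero of `Hs`; real points of `U` form a co-null set
  have hrealU : ∀ᵐ x : ℝ, (x : ℂ) ∈ U := by
    have hcnt : {x : ℝ | (x : ℂ) ∉ U}.Countable := by
      have := hcount.preimage Complex.ofReal_injective
      exact this.mono fun x hx ↦ hx
    have h0 : volume {x : ℝ | (x : ℂ) ∉ U} = 0 := hcnt.measure_zero volume
    exact ae_iff.2 (by simpa using h0)
  -- `Hs` vanishes at EVERY real point of `U` (continuity + a.e. vanishing)
  have hreal0 : ∀ x : ℝ, (x : ℂ) ∈ U → Hs x = 0 := by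
    intro x hx
    by_contra hne
    have hcont : ContinuousAt (fun y : ℝ ↦ Hs y) x :=
      ((hdiff x hx).continuousAt).comp Complex.continuous_ofReal.continuousAt
    have hopen : ∀ᶠ y : ℝ in 𝓝 x, Hs (y : ℂ) ≠ 0 := hcont.eventually_ne hne
    obtain ⟨ε, hε, hball⟩ := Metric.eventually_nhds_iff.1 hopen
    have hpos : 0 < volume (Metric.ball x ε) := Metric.measure_ball_pos volume x hε
    have hzero : volume (Metric.ball x ε) = 0 := by
      refine measure_mono_null (fun y hy ↦ ?_) (ae_iff.1 hae)
      exact hball (Metric.mem_ball.1 hy)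
    exact hpos.ne' hzero
  -- a base point and the identity theorem
  obtain ⟨x₀, hx₀⟩ : ∃ x : ℝ, (x : ℂ) ∈ U := hrealU.exists
  have hfreq : ∃ᶠ z in 𝓝[≠] ((x₀ : ℝ) : ℂ), Hs z = 0 := by
    rw [(Metric.nhdsWithin_basis_ball).frequently_iff]
    intro ε hε
    -- a real point of `U` in the punctured `ε`-ball around `x₀`
    have hposm : 0 < volume ((Metric.ball x₀ ε ∩ {y : ℝ | (y : ℂ) ∈ U}) \ {x₀}) := by
      rw [measure_sdiff_null (measure_singleton x₀)]
      have : volume (Metric.ball x₀ ε ∩ {y : ℝ | (y : ℂ) ∈ U}) = volume (Metric.ball x₀ ε) :=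
        measure_inter_conull (ae_iff.1 hrealU)
      rw [this]
      exact Metric.measure_ball_pos volume x₀ hε
    obtain ⟨y, ⟨⟨hy, hyU⟩, hyx⟩⟩ := nonempty_of_measure_ne_zero hposm.ne'
    refine ⟨y, ⟨?_, ?_⟩, hreal0 y hyU⟩
    · rw [Metric.mem_ball, dist_eq_norm, ← Complex.ofReal_sub, Complex.norm_real]
      exact mem_ball_iff_norm.1 hy
    · intro h
      apply hyx
      rw [mem_singleton_iff] at h ⊢
      exact_mod_cast h
  have hEq : EqOn Hs 0 U := hHol.eqOn_zero_of_preconnected_of_frequently_eq_zero hUconn hx₀ hfreq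
  -- residue at `p₀ = γ̄_{ρ₀}`: split off the term `ρ₀`
  set p₀ : ℂ := conj (suzukiZeroParam (ρ₀ : ℂ)) with hp₀
  set K₀ : ℂ := (riemannZetaZeroOrder (ρ₀ : ℂ) : ℂ) * c ρ₀ / conj (suzukiZeroParam (ρ₀ : ℂ))
    with hK₀
  set G : ℂ → ℂ := fun z ↦ ∑' ρ : ZetaZeros.riemannZetaNontrivialZeros, if ρ = ρ₀ then 0 else
      (riemannZetaZeroOrder (ρ : ℂ) : ℂ) * c ρ /
        (conj (suzukiZeroParam (ρ : ℂ)) * (z - conj (suzukiZeroParam (ρ : ℂ)))) with hG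
  have hGd : DifferentiableAt ℂ G p₀ := by
    have h := differentiableAt_poleSeries hC0 hc {ρ₀} (z₀ := p₀) fun ρ hρ h ↦ hρ ?_
    · simpa only [Finset.mem_singleton] using h
    · rw [Finset.mem_singleton]
      exact Subtype.ext (suzukiZeroParam_injective
        ((starRingEnd ℂ).injective (h.symm.trans hp₀)))
  have hsplit : ∀ z : ℂ, Hs z = K₀ / (z - p₀) + G z := by
    intro z
    rw [hHs, hG, hK₀, hp₀]
    simp only
    rw [(summable_poleSeries hc z).tsum_eq_add_tsum_ite ρ₀, div_mul_eq_div_div]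
  -- punctured neighbourhoods of `p₀` lie in `U` (zeros of `ξ(½ − iz) = A(z)` are isolated)
  have hpunct : ∀ᶠ z in 𝓝[≠] p₀, z ∈ U := by
    have hA : AnalyticAt ℂ lagariasXiA p₀ := differentiable_lagariasXiA.analyticAt p₀
    have h := (hA.eventually_eq_zero_or_eventually_ne_zero).resolve_left
      (lagariasXiA_not_eventually_zero p₀)
    filter_upwards [h] with z hz
    rw [hU, mem_setOf_eq, ← lagariasXiA_eq]
    exact hz
  -- on that punctured neighbourhood `K₀ = −G(z)(z − p₀)`
  have hKeq : ∀ᶠ z in 𝓝[≠] p₀, -(G z * (z - p₀)) = K₀ := by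
    filter_upwards [hpunct, self_mem_nhdsWithin] with z hzU hzp
    have hz : z - p₀ ≠ 0 := sub_ne_zero.2 hzp
    have h0 : K₀ / (z - p₀) + G z = 0 := by rw [← hsplit z]; exact hEq hzU
    field_simp at h0
    linear_combination -h0
  have hlim : Tendsto (fun z ↦ -(G z * (z - p₀))) (𝓝[≠] p₀) (𝓝 0) := by
    have h1 : Tendsto G (𝓝[≠] p₀) (𝓝 (G p₀)) :=
      tendsto_nhdsWithin_of_tendsto_nhds hGd.continuousAt.tendsto
    have h2 : Tendsto (fun z : ℂ ↦ z - p₀) (𝓝[≠] p₀) (𝓝 0) := by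
      have : Tendsto (fun z : ℂ ↦ z - p₀) (𝓝 p₀) (𝓝 (p₀ - p₀)) :=
        (continuous_id.sub continuous_const).tendsto p₀
      rw [sub_self] at this
      exact tendsto_nhdsWithin_of_tendsto_nhds this
    have := (h1.mul h2).neg
    simpa using this
  have hK0 : K₀ = 0 :=
    tendsto_nhds_unique (tendsto_const_nhds.congr' (hKeq.mono fun z hz ↦ hz.symm)) hlim
  -- conclude `c ρ₀ = 0`
  have hm : (riemannZetaZeroOrder (ρ₀ : ℂ) : ℂ) ≠ 0 := by
    have h1 := ZetaZeros.riemannZetaNontrivialZeros.one_le_order ρ₀.2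
    exact_mod_cast (by omega : riemannZetaZeroOrder (ρ₀ : ℂ) ≠ 0)
  rw [hK₀, div_eq_zero_iff, mul_eq_zero] at hK0
  rcases hK0 with (h | h) | h
  · exact (hm h).elim
  · exact h
  · exact (conj_zeroParam_ne_zero ρ₀ h).elim

/-! ## F. CJM Lemma 3.2 (iii) for the repaired seminorm, modulo Prop 3.1 -/

/-- Real points lying on `Γ` (through `x` or `−x`) form a null set, `0` is a null set, and
`E_ξ(x) ≠ 0` a.e.: almost every real `x` is a point where (3.7)ᴿ applies. [cite: Suzuki2025WeilHilbertSpace, (3.8) (TeX l.1050–1056: "P̂_φ(z) is defined for all z ∈ ℝ except for … measure zero")] -/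
theorem ae_good_point : ∀ᵐ x : ℝ, x ≠ 0 ∧ lagariasE (x : ℂ) ≠ 0 ∧
    (∀ ρ ∈ ZetaZeros.riemannZetaNontrivialZeros, (x : ℂ) ≠ suzukiZeroParam ρ) ∧
    (∀ ρ ∈ ZetaZeros.riemannZetaNontrivialZeros, -(x : ℂ) ≠ suzukiZeroParam ρ) := by
  have h0 : ∀ᵐ x : ℝ, x ≠ 0 := by
    exact ae_iff.2 (by simp)
  have hcnt : ((fun ρ : ℂ ↦ (suzukiZeroParam ρ).re) '' ZetaZeros.riemannZetaNontrivialZeros).Countable :=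
    riemannZetaNontrivialZeros_countable.image _
  have hcnt' : ((fun ρ : ℂ ↦ -(suzukiZeroParam ρ).re) '' ZetaZeros.riemannZetaNontrivialZeros).Countable :=
    riemannZetaNontrivialZeros_countable.image _
  have h1 : ∀ᵐ x : ℝ, ∀ ρ ∈ ZetaZeros.riemannZetaNontrivialZeros, (x : ℂ) ≠ suzukiZeroParam ρ := by
    have hz : volume ((fun ρ : ℂ ↦ (suzukiZeroParam ρ).re) ''
        ZetaZeros.riemannZetaNontrivialZeros) = 0 := hcnt.measure_zero volume
    refine (ae_iff.2 (measure_mono_null (fun x hx ↦ ?_) hz))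
    simp only [mem_setOf_eq, not_forall, not_not] at hx
    obtain ⟨ρ, hρ, hx⟩ := hx
    refine ⟨ρ, hρ, ?_⟩
    show (suzukiZeroParam ρ).re = x
    rw [← hx, Complex.ofReal_re]
  have h2 : ∀ᵐ x : ℝ, ∀ ρ ∈ ZetaZeros.riemannZetaNontrivialZeros, -(x : ℂ) ≠ suzukiZeroParam ρ := by
    have hz : volume ((fun ρ : ℂ ↦ -(suzukiZeroParam ρ).re) ''
        ZetaZeros.riemannZetaNontrivialZeros) = 0 := hcnt'.measure_zero volume
    refine (ae_iff.2 (measure_mono_null (fun x hx ↦ ?_) hz))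
    simp only [mem_setOf_eq, not_forall, not_not] at hx
    obtain ⟨ρ, hρ, hx⟩ := hx
    refine ⟨ρ, hρ, ?_⟩
    have := congrArg Complex.re hx
    simp at this
    show -(suzukiZeroParam ρ).re = x
    linarith
  filter_upwards [h0, ae_lagariasE_ofReal_ne_zero, h1, h2] with x a b c d
  exact ⟨a, b, c, d⟩

/-- At a good real point the prefactor of (3.7)ᴿ does not vanish: `1 + Θ(x) = 2A(x)/E(x)` with
`A(x) = ξ(½ − ix) ≠ 0` off `Γ`. [cite: Suzuki2025WeilHilbertSpace, (3.6) (TeX l.1026–1032); Suzuki2023b, (3.3)] -/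
theorem one_add_lagariasTheta_ne_zero {x : ℝ} (hE : lagariasE (x : ℂ) ≠ 0)
    (hxΓ : ∀ ρ ∈ ZetaZeros.riemannZetaNontrivialZeros, (x : ℂ) ≠ suzukiZeroParam ρ) :
    1 + lagariasTheta (x : ℂ) ≠ 0 := by
  have hA : lagariasXiA (x : ℂ) ≠ 0 := by
    rw [lagariasXiA_eq]; exact xi_ne_zero_of_forall_ne hxΓ
  have h : 1 + lagariasTheta (x : ℂ) = 2 * lagariasXiA x / lagariasE x := by
    rw [lagariasTheta, lagariasXiA]
    field_simp
  rw [h]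
  exact div_ne_zero (mul_ne_zero two_ne_zero hA) hE

end ScrewLineRepairedExpansion

open ScrewLineRepairedExpansion

/-- **CJM Lemma 3.2 (iii) for the repaired seminorm (modulo CJM Prop 3.1): `‖ψ‖₀ᴿ = 0 ⇒ ψ = 0` on
`C_c^∞(ℝ)`.** Printed proof, followed step by step over the repaired objects: `‖ψ‖₀ᴿ = 0` gives
`P̂ᴿ_{Dψ} = 0` a.e. on `ℝ`; by (3.7)ᴿ the pole series `Σ_ρ m_ρ c_ρ(Dψ)/(γ̄_ρ (x − γ̄_ρ))` vanishes
a.e. (the prefactor `1 + Θ(x) = 2ξ(½ − ix)/E(x)` is a.e. non-zero), hence identically on `ℂ ∖ Γ` and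
all residues vanish (`coeff_eq_zero_of_poleSeries_ae_zero` — "it is impossible"); so
`c_ρ(Dψ) = i∫(e^{iγ̄_ρ t} − 1)ψ′(t)dt = 0` for every zero, i.e. (pairing `ρ ↔ ρ̄`)
`∫(e^{(ρ − ½)t} − 1)ψ′(t)dt = 0` for every zero, whence `ψ′ = 0` by [Su22, Lemma 2.1]
(`Suzuki2023_lemma21_holds`, through `ZetaScrewNullSeries.ae_eq_zero_of_forall_zero`) and `ψ = 0`
by compact support. RH-FREE modulo `h31`. [cite: Suzuki2025WeilHilbertSpace, Lemma 3.2 (iii) and its proof (TeX l.1073–1093); erratum E21] -/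
theorem Suzuki2025_lemma32R_iii_of_prop31 (h31 : Suzuki2025_prop31) :
    ∀ ψ : ℝ → ℂ, IsWeilTest ψ → screwNormZeroR ψ = 0 → ψ = 0 := by
  intro ψ hψ h0
  have hφ : IsWeilTest (suzukiD ψ) := hψ.suzukiD
  -- Step 1: `∫ ‖P̂ᴿ_{Dψ}‖² = 0`, hence `P̂ᴿ_{Dψ} = 0` a.e.
  have hint0 : ∫ x : ℝ, ‖screwPhatR (suzukiD ψ) x‖ ^ 2 = 0 := by
    have h := h0
    rw [screwNormZeroR, Real.sqrt_eq_zero (div_nonneg (integral_nonneg fun _ ↦ by positivity)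
      Real.pi_pos.le), div_eq_zero_iff] at h
    exact h.resolve_right Real.pi_ne_zero
  have hmem : MemLp (fun x : ℝ ↦ screwPhatR (suzukiD ψ) x) 2 volume := memLp_screwPhatR hφ
  have hInt2 : Integrable (fun x : ℝ ↦ ‖screwPhatR (suzukiD ψ) x‖ ^ 2) :=
    (memLp_two_iff_integrable_sq_norm hmem.1).1 hmem
  have hae0 : ∀ᵐ x : ℝ, screwPhatR (suzukiD ψ) x = 0 := by
    have h := (integral_eq_zero_iff_of_nonneg (fun x ↦ by positivity) hInt2).1 hint0
    filter_upwards [h] with x hx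
    simpa using hx
  -- Step 2: the coefficients `c_ρ(Dψ)` and their bound
  set c : ZetaZeros.riemannZetaNontrivialZeros → ℂ := fun ρ ↦ ∫ t : ℝ, (cexp (I * conj (suzukiZeroParam (ρ : ℂ)) * t) - 1) *
    suzukiD ψ t with hc
  have hb : ∀ ρ : ZetaZeros.riemannZetaNontrivialZeros, |(I * conj (suzukiZeroParam (ρ : ℂ))).re| ≤ 1 / 2 := by
    intro ρ
    obtain ⟨-, h0', h1⟩ := mem_riemannZetaNontrivialZeros_iff_holds.1 ρ.2
    have : (I * conj (suzukiZeroParam (ρ : ℂ))).re = (ρ : ℂ).re - 1 / 2 := by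
      simp [suzukiZeroParam]
    rw [this]; exact abs_le.2 ⟨by linarith, by linarith⟩
  obtain ⟨M, hM0, hM⟩ := exists_setIntegral_norm_expCoeffIntegrand_le hφ
  have hcM : ∀ ρ : ZetaZeros.riemannZetaNontrivialZeros, ‖c ρ‖ ≤ M := by
    intro ρ
    refine (norm_integral_le_integral_norm _).trans ?_
    have h := hM _ (hb ρ) univ MeasurableSet.univ
    rwa [Measure.restrict_univ] at h
  -- Step 3: the pole series vanishes a.e. on `ℝ`
  have hae : ∀ᵐ x : ℝ, ∑' ρ : ZetaZeros.riemannZetaNontrivialZeros, (riemannZetaZeroOrder (ρ : ℂ) : ℂ) * c ρ /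
      (conj (suzukiZeroParam (ρ : ℂ)) * ((x : ℂ) - conj (suzukiZeroParam (ρ : ℂ)))) = 0 := by
    filter_upwards [hae0, ae_good_point] with x hx ⟨hx0, hE, hxΓ, hxΓ'⟩
    have h37 := screwPhatR_eq_tsum_of_prop31 h31 hφ hx0 hE hxΓ hxΓ'
    rw [hx] at h37
    have hK : -(I / 2) * (1 + lagariasTheta (x : ℂ)) ≠ 0 :=
      mul_ne_zero (by norm_num [Complex.ext_iff]) (one_add_lagariasTheta_ne_zero hE hxΓ)
    exact (mul_eq_zero.1 h37.symm).resolve_left hK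
  -- Step 4: all coefficients vanish ("it is impossible")
  have hc0 : ∀ ρ : ZetaZeros.riemannZetaNontrivialZeros, c ρ = 0 := coeff_eq_zero_of_poleSeries_ae_zero hM0 hcM hae
  -- Step 5: `∫ (e^{(ρ − ½)t} − 1) ψ′(t) dt = 0` for every zero (pair `ρ ↔ ρ̄`)
  have hmoment : ∀ ρ : ZetaZeros.riemannZetaNontrivialZeros, ∫ t : ℝ, (cexp (((ρ : ℂ) - 1 / 2) * t) - 1) * deriv ψ t = 0 := by
    intro ρ
    have hρ' : conj (ρ : ℂ) ∈ ZetaZeros.riemannZetaNontrivialZeros :=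
      ZetaZeros.riemannZetaNontrivialZeros.conj_mem ρ.2
    have h := hc0 ⟨conj (ρ : ℂ), hρ'⟩
    simp only [hc] at h
    have hexp : I * conj (suzukiZeroParam (conj (ρ : ℂ))) = (ρ : ℂ) - 1 / 2 := by
      rw [suzukiZeroParam_conj, map_neg, Complex.conj_conj, suzukiZeroParam]
      linear_combination (1 / 2 - (ρ : ℂ)) * Complex.I_sq
    simp only [hexp, suzukiD] at h
    have h' : I * ∫ t : ℝ, (cexp (((ρ : ℂ) - 1 / 2) * t) - 1) * deriv ψ t = 0 := by
      rw [← integral_const_mul]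
      rw [← h]
      refine integral_congr_ae (ae_of_all _ fun t ↦ ?_)
      simp only
      ring
    exact (mul_eq_zero.1 h').resolve_left Complex.I_ne_zero
  -- Step 6: `ψ′ = 0` a.e. by [Su22, Lemma 2.1], then everywhere (continuity)
  obtain ⟨R, hRpos, hR⟩ := (hψ.deriv).2.exists_pos_le_norm
  have hd0 : deriv ψ = 0 := by
    have hIoo : ∀ t : ℝ, t ∉ Ioo (-(R + 1)) (R + 1) → deriv ψ t = 0 := by
      intro t ht
      apply hR
      rw [Real.norm_eq_abs]
      simp only [mem_Ioo, not_and_or, not_lt] at ht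
      rcases ht with h | h
      · rw [abs_of_neg (by linarith)]; linarith
      · rw [abs_of_pos (by linarith)]; linarith
    have hint : Integrable (deriv ψ) (volume.restrict (Ioo (-(R + 1)) (R + 1))) :=
      ((hψ.deriv).1.continuous.integrable_of_hasCompactSupport (hψ.deriv).2).restrict
    have hnull := ZetaScrewNullSeries.ae_eq_zero_of_forall_zero Suzuki2023_lemma21_holds hint
      (fun ρ ↦ by
        rw [setIntegral_eq_integral_of_forall_compl_eq_zero (fun t ht ↦ by rw [hIoo t ht, mul_zero])]
        exact hmoment ρ)
    have hae' : deriv ψ =ᵐ[volume] 0 := by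
      have h1 : ∀ᵐ t : ℝ, t ∈ Ioo (-(R + 1)) (R + 1) → deriv ψ t = 0 :=
        (ae_restrict_iff' measurableSet_Ioo).1 hnull
      filter_upwards [h1] with t ht
      by_cases hmem : t ∈ Ioo (-(R + 1)) (R + 1)
      · exact ht hmem
      · exact hIoo t hmem
    exact (Continuous.ae_eq_iff_eq volume (hψ.deriv).1.continuous continuous_const).1 hae'
  -- Step 7: `ψ` is constant, and vanishes far out
  obtain ⟨R₀, hR₀pos, hR₀⟩ := hψ.2.exists_pos_le_norm
  have hdiff : Differentiable ℝ ψ := hψ.1.differentiable (by simp)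
  funext x
  rw [is_const_of_deriv_eq_zero hdiff (fun t ↦ by rw [hd0]; rfl) x R₀]
  exact hR₀ R₀ (by rw [Real.norm_eq_abs, abs_of_pos hR₀pos])

/-- **CJM Lemma 3.2 for the repaired seminorm, modulo CJM Prop 3.1**: (i) and (ii) are the
unconditional `Suzuki2025_lemma32R_subadd` / `Suzuki2025_lemma32R_absHom`, (iii) is
`Suzuki2025_lemma32R_iii_of_prop31`. The only open input is the RH-free printed identity
`Suzuki2025_prop31` (row α of the cell). [cite: Suzuki2025WeilHilbertSpace, Lemma 3.2 (TeX l.1073–1093); erratum E21] -/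
theorem Suzuki2025_lemma32R_of_prop31 (h31 : Suzuki2025_prop31) : Suzuki2025_lemma32R :=
  Suzuki2025_lemma32R_of_definite (Suzuki2025_lemma32R_iii_of_prop31 h31)

/-! ## G. The all-`t` zero expansion of the repaired screw function (modulo Prop 3.1) -/

/-- **`𝔓ᴿ_t = P_t` for ALL real `t` (modulo CJM Prop 3.1)** — the repaired analogue of Prop 3.1 with
the zero expansion `P_t(z) = Σ_γ m_γ (e^{−iγt} − 1)/γ · 1/(z − γ)` of (3.2) taken literally for
negative `t` (`screwZeroExpansionR`, no `|t|`): for `t ≥ 0` this is Prop 3.1; for `t < 0` it is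
Prop 3.1 at `(|t|, −z)` followed by the reflection `γ ↦ −γ` of `Γ`. Typed off `Γ` and off the
cancelling poles of BOTH `𝔓_{|t|}(±z)`. RH-FREE modulo `h31`.
[cite: Suzuki2025WeilHilbertSpace, Prop. 3.1 (TeX l.789–793) with (3.2); erratum E21] -/
theorem screwPR_eq_screwZeroExpansionR_of_prop31 (h31 : Suzuki2025_prop31) (t : ℝ) {z : ℂ}
    (hz0 : z ≠ 0) (hzI : z ≠ I / 2) (hzI' : z ≠ -(I / 2))
    (hzn : ∀ n : ℕ, z ≠ -(I * (2 * n + 1 / 2))) (hzn' : ∀ n : ℕ, z ≠ I * (2 * n + 1 / 2))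
    (hzΓ : ∀ ρ ∈ ZetaZeros.riemannZetaNontrivialZeros, z ≠ suzukiZeroParam ρ) :
    screwPR t z = screwZeroExpansionR t z := by
  rcases le_or_gt 0 t with ht | ht
  · rw [screwPR_of_nonneg ht, h31 t z hz0 hzI hzn hzΓ, screwZeroExpansion, screwZeroExpansionR,
      abs_of_nonneg ht]
  · have hz0' : -z ≠ 0 := neg_ne_zero.2 hz0
    have hzI2 : -z ≠ I / 2 := fun h ↦ hzI' (by rw [← h, neg_neg])
    have hzn2 : ∀ n : ℕ, -z ≠ -(I * (2 * n + 1 / 2)) := fun n h ↦ hzn' n (neg_injective h)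
    have hzΓ2 : ∀ ρ ∈ ZetaZeros.riemannZetaNontrivialZeros, -z ≠ suzukiZeroParam ρ := by
      intro ρ hρ h
      refine hzΓ (1 - ρ) (ZetaZeros.riemannZetaNontrivialZeros.one_sub_mem hρ) ?_
      rw [suzukiZeroParam_one_sub, ← h, neg_neg]
    rw [screwPR_of_neg ht, h31 (-t) (-z) hz0' hzI2 hzn2 hzΓ2, screwZeroExpansion,
      screwZeroExpansionR, abs_neg, abs_of_neg ht]
    have hinv : Function.Involutive (fun ρ : ZetaZeros.riemannZetaNontrivialZeros ↦ (⟨1 - (ρ : ℂ), oneSub_mem ρ⟩ : ZetaZeros.riemannZetaNontrivialZeros)) := by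
      intro ρ; ext; simp
    rw [← Equiv.tsum_eq (hinv.toPerm _)]
    refine tsum_congr fun ρ ↦ ?_
    have hγe : suzukiZeroParam ((hinv.toPerm _ ρ : ZetaZeros.riemannZetaNontrivialZeros) : ℂ) = -suzukiZeroParam (ρ : ℂ) := by
      simp only [Function.Involutive.coe_toPerm]
      exact suzukiZeroParam_one_sub _
    have hme : (riemannZetaZeroOrder ((hinv.toPerm _ ρ : ZetaZeros.riemannZetaNontrivialZeros) : ℂ) : ℂ) =
        riemannZetaZeroOrder (ρ : ℂ) := by
      simp only [Function.Involutive.coe_toPerm]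
      exact_mod_cast riemannZetaZeroOrder_one_sub_of_mem ρ.2
    rw [hγe, hme]
    have hexp : cexp (-(I * -suzukiZeroParam (ρ : ℂ) * ((-t : ℝ) : ℂ))) =
        cexp (-(I * suzukiZeroParam (ρ : ℂ) * (t : ℂ))) := by
      congr 1; push_cast; ring
    rw [hexp, div_neg, show -z - -suzukiZeroParam (ρ : ℂ) = -(z - suzukiZeroParam (ρ : ℂ)) by ring,
      one_div_neg_eq_neg_one_div]
    ring

end Literature.NumberTheory.LFunctions
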